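import Literature.AlgebraicGeometry.Deformation.SmoothSchemeLiftObstructionCocycle
import HarnessLib

/-!
# Twisted unit cocycles on a trivial deformation along a small extension: defect, change of lifts,
# the fourfold identity, and the MOVE under infinitesimal automorphisms (ring level)

Layer `Literature/AlgebraicGeometry/Deformation` (cell `hodgecm-mathlib`, F-11 sub-line `F11SmoothRoadA`, α1-(iii) «PAIRS
obstruction + move lemma», ring-level engine; theorems only — no definition, no instance, no notation, no named fact).
Sequel of ★ `SmoothAffineDeformationsTrivial` (Hartshorne DT Lemma 4.5 / Remark 10.1.1: `θ_D = id + D̃` on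
`A' ⊗_k B₀`) and ★ `SmoothSchemeLiftObstructionCocycle` (centrality `θ_D ψ' = ψ' θ_D`).

SETTING (one overlap ring at a time, exactly as in those files).  `k` a commutative ring, `A'` a commutative
`k`-algebra with ideals `J`, `𝔫'` such that `J² = 0` and `J𝔫' = 0` (a small extension `A' → A'/J`, `𝔫'` the
nilpotent ideal of the closed fibre), `B₀` a commutative `k`-algebra (the coordinate ring of an affine open of the
closed fibre), `R := A' ⊗_k B₀` the trivial deformation; `ι := idealTensorIncl J : B₀ ⊗_k J → R` (`b ⊗ j ↦ j ⊗ b`, image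
`J·R`).  A deformation glued from trivial pieces has TRANSITION automorphisms `ρ ∈ Aut_{A'}(R)` inducing the identity
modulo `𝔫'`; an invertible sheaf on it, trivialised on the pieces, has TRANSITION UNITS `G ∈ R` lifting units
`g ∈ B₀` of the closed fibre (`G ≡ 1 ⊗ g (mod 𝔫')`).  On a triple overlap (all data moved to one ring) the TWISTED
DEFECT `σ` of three lifted units `G₁ = G_{jm}`, `G₂ = G_{jl}`, `G₃ = G_{lm}` against the transition `ρ = ρ_{jl}` is the
element with
  `G₁ · σ = G₂ · ρ(G₃)`
(we never divide: `σ` is CHARACTERISED by this relation and unique because `G₁` is a unit, §1); the lifted units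
glue to an invertible sheaf on the lifted scheme iff `σ = 1` on all triples; `σ ≡ 1 (mod J)` says that they glue
modulo `J`, and then `σ = 1 + ι(s)` for a `2`-cochain `s` with coefficients in `B₀ ⊗_k J` — the OBSTRUCTION cochain of
the pair (deformation, invertible sheaf) ([Oort1971] §2.3; [Hartshorne2010] Thm. 6.4 (a) for the untwisted case
`ρ = 1`; [Sernesi2006] Thm. 3.3.11 for pairs `(X, L)`).

WHAT IS PROVED (pure commutative algebra; every statement is an identity in `R`):
* §1 products `𝔫'R · JR = 0`, `JR · JR = 0`; `x · ι(m) = ι(c • m)` for `x ≡ 1 ⊗ c (mod 𝔫')`; `θ_D(x) = x + ι(D c)` for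
  such `x`; units: `x ≡ 1 ⊗ g (mod 𝔫')` with `g` a unit and `𝔫'` nilpotent is a unit.
* §2 **CHANGE OF LIFTS** (`twistedDefect_change_of_lifts`): replacing `Gᵢ` by `Gᵢ + ι(gᵢ • hᵢ)` replaces `σ` by
  `σ + ι(h₂ + h₃ − h₁)` — the obstruction cochain changes by a Čech coboundary; hence (`twistedDefect_eq_one_of_eq`)
  if `σ = 1 + ι(h₁ − h₂ − h₃)` the corrected lifts have defect `1` («the invertible sheaf lifts iff the class
  vanishes», ⇐).
* §3 **THE FOURFOLD IDENTITY** (`twistedDefect_fourfold`): for cocycle-exact transitions (`ρ_{jl} ρ_{lm} = ρ_{jm}`) the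
  four defects on a fourfold overlap satisfy `σ_{jln} σ_{lmn} = σ_{jlm} σ_{jmn}`, i.e. `s` is a Čech `2`-COCYCLE
  (`s_{lmn} − s_{jmn} + s_{jln} − s_{jlm} = 0`, `twistedDefect_fourfold_add`).
* §4 **THE MOVE LEMMA** (`twistedDefect_move`, `twistedDefect_move_of_cocycle`): replacing the transition `ρ` by
  `θ_D ρ` (moving the LIFT OF THE SCHEME by the derivation `D`, [Hartshorne2010] Remark 10.1.1) and keeping the units
  replaces `σ` by `σ + ι(g₃⁻¹ • D g₃)` — «the obstruction to lifting `L` changes by the cup product of the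
  Kodaira–Spencer cochain with `dlog` of the transition functions of `L`» ([Sernesi2006] (3.38): the connecting map
  `H¹(T_X) → H²(𝒪_X)` is `∪ c₁(L)`); and the moved transitions are again admissible: `≡ 1 (mod 𝔫')`
  (`sub_mem_smul_top_infinitesimalAut_mul`) and COCYCLE-EXACT when `D` is a cocycle (`infinitesimalAut_mul_cocycle`).

Scheme-level bookkeeping (Čech cochains on a principal affine cover of the closed fibre, as in
`Deformation/SmoothSchemeLiftObstructionCechCocycle`) is NOT in this file.  HC_CM is proved only modulo the 7 printed
citations until rung 0 closes — nothing here bears on a summit statement.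

## References
* [Hartshorne2010] R. Hartshorne, *Deformation Theory*, GTM 257 (2010): Lemma 4.5 (p. 31), Thm. 6.4 (a) and proof
  (pp. 50–51), Remark 10.1.1 (p. 80), Thm. 10.2 (a) proof (p. 81).
* [Oort1971] F. Oort, *Finite group schemes, local moduli for abelian varieties, and lifting problems*, Compositio
  Math. 23 (1971), §2.3.
* [Sernesi2006] E. Sernesi, *Deformations of Algebraic Schemes*, Grundlehren 334 (2006), Thm. 3.3.11 and (3.38).
-/

open TensorProduct

namespace Literature.AlgebraicGeometry.Deformation.SmoothAffineDeformation

variable {k : Type*} [CommRing k]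
variable {A' : Type*} [CommRing A'] [Algebra k A']
variable {B₀ : Type*} [CommRing B₀] [Algebra k B₀]

/-! ## §1 Products of small elements; units modulo `𝔫'` -/

section Small

variable (J : Ideal A')

/-- `R · (I·R) ⊆ I·R`: left multiples of elements of `I(A' ⊗_k B₀)` stay there. [cite: Hartshorne2010, Lemma 4.5, p. 31] -/
theorem mul_mem_smul_top {I : Ideal A'} (a : A' ⊗[k] B₀) {y : A' ⊗[k] B₀}
    (hy : y ∈ I • (⊤ : Submodule A' (A' ⊗[k] B₀))) : a * y ∈ I • (⊤ : Submodule A' (A' ⊗[k] B₀)) := by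
  rw [Ideal.smul_top_eq_map, Submodule.restrictScalars_mem] at hy ⊢
  exact Ideal.mul_mem_left _ a hy

/-- `(I·R) · R ⊆ I·R`. [cite: Hartshorne2010, Lemma 4.5, p. 31] -/
theorem mul_mem_smul_top' {I : Ideal A'} {x : A' ⊗[k] B₀} (hx : x ∈ I • (⊤ : Submodule A' (A' ⊗[k] B₀)))
    (a : A' ⊗[k] B₀) : x * a ∈ I • (⊤ : Submodule A' (A' ⊗[k] B₀)) := by
  rw [mul_comm]; exact mul_mem_smul_top a hx

/-- `(I·R)(I'·R) = 0` when `I I' = 0` (e.g. `𝔫'R · JR = 0` for a small extension, `JR · JR = 0`).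
[cite: Hartshorne2010, Thm. 10.2 (proof), p. 81] -/
theorem mul_eq_zero_of_mem_smul_top_of_mem_smul_top {I I' : Ideal A'} (h : I * I' = ⊥) {x y : A' ⊗[k] B₀}
    (hx : x ∈ I • (⊤ : Submodule A' (A' ⊗[k] B₀))) (hy : y ∈ I' • (⊤ : Submodule A' (A' ⊗[k] B₀))) :
    x * y = 0 := by
  rw [Ideal.smul_top_eq_map, Submodule.restrictScalars_mem] at hx hy
  have hxy := Ideal.mul_mem_mul hx hy
  rw [← Ideal.map_mul, h, Ideal.map_bot] at hxy
  simpa using hxy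

/-- `J·R ⊆ 𝔫'·R` when `J ≤ 𝔫'`. [cite: Hartshorne2010, Thm. 10.2 (proof), p. 81] -/
theorem smul_top_mono {I I' : Ideal A'} (h : I ≤ I') :
    I • (⊤ : Submodule A' (A' ⊗[k] B₀)) ≤ I' • (⊤ : Submodule A' (A' ⊗[k] B₀)) :=
  Submodule.smul_mono h le_rfl

/-- **`x · ι(m) = ι(c • m)` for `x ≡ 1 ⊗ c (mod 𝔫')`** (`𝔫' J = 0`): multiplying an element of `J·R` by `x` only sees
the reduction `c` of `x`. [cite: Hartshorne2010, Remark 10.1.1, p. 80] -/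
theorem mul_idealTensorIncl_of_sub_mem {𝔫' : Ideal A'} (hJ𝔫 : J * 𝔫' = ⊥) {x : A' ⊗[k] B₀} {c : B₀}
    (hx : x - (1 : A') ⊗ₜ c ∈ 𝔫' • (⊤ : Submodule A' (A' ⊗[k] B₀))) (m : B₀ ⊗[k] ↥(J.restrictScalars k)) :
    x * idealTensorIncl J m = idealTensorIncl J (c • m) := by
  have h0 : (x - (1 : A') ⊗ₜ c) * idealTensorIncl J m = 0 :=
    mul_eq_zero_of_mem_smul_top_of_mem_smul_top (by rwa [mul_comm] at hJ𝔫) hx (idealTensorIncl_mem J m)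
  rw [sub_mul, sub_eq_zero] at h0
  rw [h0, idealTensorIncl_smul]

/-- The same on the right: `ι(m) · x = ι(c • m)`. [cite: Hartshorne2010, Remark 10.1.1, p. 80] -/
theorem idealTensorIncl_mul_of_sub_mem {𝔫' : Ideal A'} (hJ𝔫 : J * 𝔫' = ⊥) {x : A' ⊗[k] B₀} {c : B₀}
    (hx : x - (1 : A') ⊗ₜ c ∈ 𝔫' • (⊤ : Submodule A' (A' ⊗[k] B₀))) (m : B₀ ⊗[k] ↥(J.restrictScalars k)) :
    idealTensorIncl J m * x = idealTensorIncl J (c • m) := by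
  rw [mul_comm, mul_idealTensorIncl_of_sub_mem J hJ𝔫 hx]

/-- **`θ_D(x) = x + ι(D c)` for `x ≡ 1 ⊗ c (mod 𝔫')`**: the infinitesimal automorphism of a derivation `D` only sees the
reduction of `x` (`D̃` kills `𝔫'·R` as `J𝔫' = 0`). [cite: Hartshorne2010, Remark 10.1.1, p. 80] -/
theorem infinitesimalAut_apply_of_sub_mem (hJ : J * J = ⊥) {𝔫' : Ideal A'} (hJ𝔫 : J * 𝔫' = ⊥)
    (D : Derivation k B₀ (B₀ ⊗[k] ↥(J.restrictScalars k))) {x : A' ⊗[k] B₀} {c : B₀}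
    (hx : x - (1 : A') ⊗ₜ c ∈ 𝔫' • (⊤ : Submodule A' (A' ⊗[k] B₀))) :
    infinitesimalAut J hJ D x = x + idealTensorIncl J (D c) := by
  have hsplit : x = (x - (1 : A') ⊗ₜ c) + (1 : A') ⊗ₜ c := by abel
  rw [infinitesimalAut_apply, add_right_inj]
  conv_lhs => rw [hsplit]
  rw [map_add, derivationExtension_apply_eq_zero_of_mem_smul J hJ𝔫 D hx, zero_add, derivationExtension_tmul,
    one_smul]

/-- `ρ x ≡ 1 ⊗ c (mod 𝔫')` if `x ≡ 1 ⊗ c (mod 𝔫')` and `ρ` induces the identity modulo `𝔫'`.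
[cite: Hartshorne2010, Thm. 10.2 (proof), p. 81] -/
theorem apply_sub_tmul_mem {𝔫' : Ideal A'} (ρ : A' ⊗[k] B₀ ≃ₐ[A'] A' ⊗[k] B₀)
    (hρ : ∀ y, ρ y - y ∈ 𝔫' • (⊤ : Submodule A' (A' ⊗[k] B₀))) {x : A' ⊗[k] B₀} {c : B₀}
    (hx : x - (1 : A') ⊗ₜ c ∈ 𝔫' • (⊤ : Submodule A' (A' ⊗[k] B₀))) :
    ρ x - (1 : A') ⊗ₜ c ∈ 𝔫' • (⊤ : Submodule A' (A' ⊗[k] B₀)) := by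
  have h : ρ x - (1 : A') ⊗ₜ c = (ρ x - x) + (x - (1 : A') ⊗ₜ c) := by abel
  rw [h]
  exact Submodule.add_mem _ (hρ x) hx

/-- An automorphism inducing the identity modulo `𝔫'` fixes `σ` when `σ ≡ 1 (mod J)` (`J𝔫' = 0`).
[cite: Hartshorne2010, Thm. 10.2 (proof), p. 81] -/
theorem apply_eq_self_of_sub_one_mem {𝔫' : Ideal A'} (hJ𝔫 : J * 𝔫' = ⊥) (ρ : A' ⊗[k] B₀ ≃ₐ[A'] A' ⊗[k] B₀)
    (hρ : ∀ y, ρ y - y ∈ 𝔫' • (⊤ : Submodule A' (A' ⊗[k] B₀))) {σ : A' ⊗[k] B₀}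
    (hσ : σ - 1 ∈ J • (⊤ : Submodule A' (A' ⊗[k] B₀))) : ρ σ = σ := by
  have h : σ = 1 + (σ - 1) := by abel
  rw [h, map_add, map_one, apply_eq_self_of_mem_smul J hJ𝔫 ρ hρ hσ]

/-- **A lift of a unit is a unit**: `x ≡ 1 ⊗ g (mod 𝔫')` with `g` a unit of `B₀` and `𝔫'` nilpotent is a unit of
`A' ⊗_k B₀`. [cite: Hartshorne2010, Thm. 6.4 (proof), pp. 50–51] -/
theorem isUnit_of_sub_tmul_mem {𝔫' : Ideal A'} (h𝔫 : IsNilpotent 𝔫') {x : A' ⊗[k] B₀} {g : B₀} (hg : IsUnit g)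
    (hx : x - (1 : A') ⊗ₜ g ∈ 𝔫' • (⊤ : Submodule A' (A' ⊗[k] B₀))) : IsUnit x := by
  have hu : IsUnit ((1 : A') ⊗ₜ[k] g : A' ⊗[k] B₀) :=
    hg.map (Algebra.TensorProduct.includeRight : B₀ →ₐ[k] A' ⊗[k] B₀)
  have hnil : IsNilpotent (x - (1 : A') ⊗ₜ[k] g) := by
    rw [Ideal.smul_top_eq_map, Submodule.restrictScalars_mem] at hx
    obtain ⟨n, hn⟩ := isNilpotent_map_of_isNilpotent (A := A') (B' := A' ⊗[k] B₀) h𝔫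
    exact ⟨n, by
      have hmem := Ideal.pow_mem_pow hx n
      rw [hn] at hmem
      exact (Ideal.mem_bot).mp hmem⟩
  have hx' : x = (1 : A') ⊗ₜ[k] g + (x - (1 : A') ⊗ₜ[k] g) := by abel
  rw [hx']
  exact hnil.isUnit_add_left_of_commute hu (Commute.all _ _)

/-- Cancellation of a unit lift: `G σ = G σ' ⇒ σ = σ'` (`G ≡ 1 ⊗ g (mod 𝔫')`, `g` a unit, `𝔫'` nilpotent) — the twisted
defect is DETERMINED by its defining relation. [cite: Hartshorne2010, Thm. 6.4 (proof), pp. 50–51] -/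
theorem eq_of_unit_mul_eq {𝔫' : Ideal A'} (h𝔫 : IsNilpotent 𝔫') {G : A' ⊗[k] B₀} {g : B₀} (hg : IsUnit g)
    (hG : G - (1 : A') ⊗ₜ g ∈ 𝔫' • (⊤ : Submodule A' (A' ⊗[k] B₀))) {σ σ' : A' ⊗[k] B₀} (h : G * σ = G * σ') :
    σ = σ' :=
  (isUnit_of_sub_tmul_mem h𝔫 hg hG).mul_left_cancel h

end Small

/-! ## §2 Change of lifts: the defect changes by a Čech coboundary -/

section Change

variable (J : Ideal A') (hJ : J * J = ⊥) {𝔫' : Ideal A'} (hJ𝔫 : J * 𝔫' = ⊥) (hJle : J ≤ 𝔫')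
  (ρ : A' ⊗[k] B₀ ≃ₐ[A'] A' ⊗[k] B₀) (hρ : ∀ y, ρ y - y ∈ 𝔫' • (⊤ : Submodule A' (A' ⊗[k] B₀)))

include hJ hJ𝔫 hJle hρ in
/-- **Change of lifts.**  Let `G₁ σ = G₂ ρ(G₃)` be the twisted defect of lifted units `Gᵢ ≡ 1 ⊗ gᵢ (mod 𝔫')` of a
closed-fibre cocycle `g₂ g₃ = g₁`, with `σ ≡ 1 (mod J)`.  Replacing the lifts by `Gᵢ + ι(gᵢ • hᵢ)` (`hᵢ ∈ B₀ ⊗_k J`;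
multiplicatively `Gᵢ (1 + ι(hᵢ))`) replaces `σ` by `σ + ι(h₂ + h₃ − h₁)`: the obstruction cochain moves by the Čech
coboundary of `h`. [cite: Hartshorne2010, Thm. 6.4 (a) (proof), pp. 50–51] [cite: Oort1971, §2.3] -/
theorem twistedDefect_change_of_lifts {G₁ G₂ G₃ σ : A' ⊗[k] B₀} {g₁ g₂ g₃ : B₀}
    (hG₁ : G₁ - (1 : A') ⊗ₜ g₁ ∈ 𝔫' • (⊤ : Submodule A' (A' ⊗[k] B₀)))
    (hG₂ : G₂ - (1 : A') ⊗ₜ g₂ ∈ 𝔫' • (⊤ : Submodule A' (A' ⊗[k] B₀)))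
    (hG₃ : G₃ - (1 : A') ⊗ₜ g₃ ∈ 𝔫' • (⊤ : Submodule A' (A' ⊗[k] B₀)))
    (hσ : G₁ * σ = G₂ * ρ G₃) (hσJ : σ - 1 ∈ J • (⊤ : Submodule A' (A' ⊗[k] B₀))) (hg : g₂ * g₃ = g₁)
    (h₁ h₂ h₃ : B₀ ⊗[k] ↥(J.restrictScalars k)) :
    (G₁ + idealTensorIncl J (g₁ • h₁)) * (σ + idealTensorIncl J (h₂ + h₃ - h₁)) =
      (G₂ + idealTensorIncl J (g₂ • h₂)) * ρ (G₃ + idealTensorIncl J (g₃ • h₃)) := by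
  -- `σ ≡ 1 ⊗ 1 (mod 𝔫')` and `ρ G₃ ≡ 1 ⊗ g₃ (mod 𝔫')`
  have hσ𝔫 : σ - (1 : A') ⊗ₜ (1 : B₀) ∈ 𝔫' • (⊤ : Submodule A' (A' ⊗[k] B₀)) := by
    rw [← Algebra.TensorProduct.one_def]
    exact smul_top_mono hJle hσJ
  have hρG₃ := apply_sub_tmul_mem ρ hρ hG₃
  -- products of two elements of `J·R` vanish
  have hJJ : ∀ m m' : B₀ ⊗[k] ↥(J.restrictScalars k), idealTensorIncl J m * idealTensorIncl (A' := A') J m' = 0 :=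
    fun m m' => mul_eq_zero_of_mem_of_mem hJ (idealTensorIncl_mem J m) (idealTensorIncl_mem J m')
  -- expand both sides
  have lhs : (G₁ + idealTensorIncl J (g₁ • h₁)) * (σ + idealTensorIncl J (h₂ + h₃ - h₁)) =
      G₁ * σ + idealTensorIncl J (g₁ • (h₂ + h₃)) := by
    rw [add_mul, mul_add, mul_add, mul_idealTensorIncl_of_sub_mem J hJ𝔫 hG₁, idealTensorIncl_mul_of_sub_mem J hJ𝔫 hσ𝔫,
      hJJ, add_zero, one_smul, add_assoc, ← map_add, smul_sub, sub_add_cancel]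
  have rhs : (G₂ + idealTensorIncl J (g₂ • h₂)) * ρ (G₃ + idealTensorIncl J (g₃ • h₃)) =
      G₂ * ρ G₃ + idealTensorIncl J (g₁ • (h₂ + h₃)) := by
    rw [map_add, apply_eq_self_of_mem_smul J hJ𝔫 ρ hρ (idealTensorIncl_mem J (g₃ • h₃)), add_mul, mul_add, mul_add,
      mul_idealTensorIncl_of_sub_mem J hJ𝔫 hG₂, idealTensorIncl_mul_of_sub_mem J hJ𝔫 hρG₃, hJJ, add_zero, smul_smul,
      smul_smul, hg, mul_comm g₃ g₂, hg, add_assoc, ← map_add, ← smul_add, add_comm h₃ h₂]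
  rw [lhs, rhs, hσ]

include hJ hJ𝔫 hJle hρ in
/-- **The invertible sheaf lifts when its obstruction cochain is a coboundary** (⇐ of [Hartshorne2010] Thm. 6.4 (a), twisted
form): if `σ = 1 + ι(h₁ − h₂ − h₃)` then the corrected lifts `Gᵢ + ι(gᵢ • hᵢ)` have twisted defect EXACTLY `1`.
[cite: Hartshorne2010, Thm. 6.4 (a) (proof), pp. 50–51] [cite: Oort1971, §2.3] -/
theorem twistedDefect_eq_one_of_eq {G₁ G₂ G₃ σ : A' ⊗[k] B₀} {g₁ g₂ g₃ : B₀}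
    (hG₁ : G₁ - (1 : A') ⊗ₜ g₁ ∈ 𝔫' • (⊤ : Submodule A' (A' ⊗[k] B₀)))
    (hG₂ : G₂ - (1 : A') ⊗ₜ g₂ ∈ 𝔫' • (⊤ : Submodule A' (A' ⊗[k] B₀)))
    (hG₃ : G₃ - (1 : A') ⊗ₜ g₃ ∈ 𝔫' • (⊤ : Submodule A' (A' ⊗[k] B₀)))
    (hσ : G₁ * σ = G₂ * ρ G₃) (hg : g₂ * g₃ = g₁) {h₁ h₂ h₃ : B₀ ⊗[k] ↥(J.restrictScalars k)}
    (hσh : σ = 1 + idealTensorIncl J (h₁ - h₂ - h₃)) :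
    (G₁ + idealTensorIncl J (g₁ • h₁)) * 1 =
      (G₂ + idealTensorIncl J (g₂ • h₂)) * ρ (G₃ + idealTensorIncl J (g₃ • h₃)) := by
  have hσJ : σ - 1 ∈ J • (⊤ : Submodule A' (A' ⊗[k] B₀)) := by
    rw [hσh, add_sub_cancel_left]; exact idealTensorIncl_mem J _
  have h := twistedDefect_change_of_lifts J hJ hJ𝔫 hJle ρ hρ hG₁ hG₂ hG₃ hσ hσJ hg h₁ h₂ h₃
  have e : σ + idealTensorIncl J (h₂ + h₃ - h₁) = 1 := by
    rw [hσh, add_assoc, ← map_add]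
    have : h₁ - h₂ - h₃ + (h₂ + h₃ - h₁) = 0 := by abel
    rw [this, map_zero, add_zero]
  rwa [e] at h

end Change

/-! ## §3 The fourfold identity: the obstruction cochain is a Čech `2`-cocycle -/

section Fourfold

variable (J : Ideal A') {𝔫' : Ideal A'} (hJ𝔫 : J * 𝔫' = ⊥) (h𝔫 : IsNilpotent 𝔫')

include hJ𝔫 h𝔫 in
/-- **The fourfold identity (multiplicative form).**  On a fourfold overlap `jlmn` (all data in one ring), let the
transitions be COCYCLE-EXACT, `ρ_{jl} ρ_{lm} = ρ_{jm}`, and `≡ 1 (mod 𝔫')`; let the four twisted defects be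
`G_{jm} σ_{jlm} = G_{jl} ρ_{jl}(G_{lm})`, `G_{jn} σ_{jmn} = G_{jm} ρ_{jm}(G_{mn})`, `G_{jn} σ_{jln} = G_{jl} ρ_{jl}(G_{ln})`,
`G_{ln} σ_{lmn} = G_{lm} ρ_{lm}(G_{mn})` with `σ ≡ 1 (mod J)` and `G_{jn}` a unit lift.  Then
`σ_{jln} σ_{lmn} = σ_{jlm} σ_{jmn}` (the rank-one case of the twisted cocycle identity `T̃ c − c + c − c T̃ = 0` of lifted
transition matrices). [cite: Hartshorne2010, Thm. 6.4 (a) (proof), pp. 50–51] -/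
theorem twistedDefect_fourfold (ρjl ρlm ρjm : A' ⊗[k] B₀ ≃ₐ[A'] A' ⊗[k] B₀)
    (hρjl : ∀ y, ρjl y - y ∈ 𝔫' • (⊤ : Submodule A' (A' ⊗[k] B₀))) (hcoc : ∀ x, ρjl (ρlm x) = ρjm x)
    {Gjl Gjm Gjn Glm Gln Gmn σjlm σjmn σjln σlmn : A' ⊗[k] B₀} {gjn : B₀} (hgjn : IsUnit gjn)
    (hGjn : Gjn - (1 : A') ⊗ₜ gjn ∈ 𝔫' • (⊤ : Submodule A' (A' ⊗[k] B₀)))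
    (h1 : Gjm * σjlm = Gjl * ρjl Glm) (h2 : Gjn * σjmn = Gjm * ρjm Gmn) (h3 : Gjn * σjln = Gjl * ρjl Gln)
    (h4 : Gln * σlmn = Glm * ρlm Gmn) (hσlmn : σlmn - 1 ∈ J • (⊤ : Submodule A' (A' ⊗[k] B₀))) :
    σjln * σlmn = σjlm * σjmn := by
  -- transport `h4` to the chart `j` along `ρjl`; `ρjl` fixes `σlmn ≡ 1 (mod J)`
  have h4' : ρjl Gln * σlmn = ρjl Glm * ρjm Gmn := by
    have := congrArg ρjl h4
    rwa [map_mul, map_mul, hcoc, apply_eq_self_of_sub_one_mem J hJ𝔫 ρjl hρjl hσlmn] at this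
  apply eq_of_unit_mul_eq h𝔫 hgjn hGjn
  calc Gjn * (σjln * σlmn) = Gjl * (ρjl Gln * σlmn) := by rw [← mul_assoc, h3, mul_assoc]
    _ = σjlm * (Gjm * ρjm Gmn) := by rw [h4', ← mul_assoc, ← h1]; ring
    _ = Gjn * (σjlm * σjmn) := by rw [← h2]; ring

include hJ𝔫 h𝔫 in
/-- **The fourfold identity (additive form): the obstruction cochain is a Čech `2`-cocycle.**  With `σ = 1 + ι(s)` on each
triple (`J² = 0`, `B₀` flat over `k` so that `ι` is injective): `s_{lmn} − s_{jmn} + s_{jln} − s_{jlm} = 0`.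
[cite: Hartshorne2010, Thm. 6.4 (a) (proof), pp. 50–51] [cite: Oort1971, §2.3] -/
theorem twistedDefect_fourfold_add [Module.Flat k B₀] (hJ : J * J = ⊥) (ρjl ρlm ρjm : A' ⊗[k] B₀ ≃ₐ[A'] A' ⊗[k] B₀)
    (hρjl : ∀ y, ρjl y - y ∈ 𝔫' • (⊤ : Submodule A' (A' ⊗[k] B₀))) (hcoc : ∀ x, ρjl (ρlm x) = ρjm x)
    {Gjl Gjm Gjn Glm Gln Gmn : A' ⊗[k] B₀} {gjn : B₀} (hgjn : IsUnit gjn)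
    (hGjn : Gjn - (1 : A') ⊗ₜ gjn ∈ 𝔫' • (⊤ : Submodule A' (A' ⊗[k] B₀)))
    {sjlm sjmn sjln slmn : B₀ ⊗[k] ↥(J.restrictScalars k)}
    (h1 : Gjm * (1 + idealTensorIncl J sjlm) = Gjl * ρjl Glm) (h2 : Gjn * (1 + idealTensorIncl J sjmn) = Gjm * ρjm Gmn)
    (h3 : Gjn * (1 + idealTensorIncl J sjln) = Gjl * ρjl Gln) (h4 : Gln * (1 + idealTensorIncl J slmn) = Glm * ρlm Gmn) :
    slmn - sjmn + sjln - sjlm = 0 := by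
  have hJJ : ∀ m m' : B₀ ⊗[k] ↥(J.restrictScalars k), idealTensorIncl J m * idealTensorIncl (A' := A') J m' = 0 :=
    fun m m' => mul_eq_zero_of_mem_of_mem hJ (idealTensorIncl_mem J m) (idealTensorIncl_mem J m')
  have hmul : ∀ m m' : B₀ ⊗[k] ↥(J.restrictScalars k),
      (1 + idealTensorIncl (A' := A') J m) * (1 + idealTensorIncl J m') = 1 + idealTensorIncl J (m + m') := by
    intro m m'
    rw [add_mul, one_mul, mul_add, mul_one, hJJ, add_zero, map_add, add_assoc, add_comm (idealTensorIncl J m')]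
  have h := twistedDefect_fourfold J hJ𝔫 h𝔫 ρjl ρlm ρjm hρjl hcoc hgjn hGjn h1 h2 h3 h4
    (by rw [add_sub_cancel_left]; exact idealTensorIncl_mem J _)
  rw [hmul, hmul, add_right_inj] at h
  have h' := idealTensorIncl_injective J h
  rw [← sub_eq_zero] at h'
  have : sjln + slmn - (sjlm + sjmn) = slmn - sjmn + sjln - sjlm := by abel
  rwa [this] at h'

end Fourfold

/-! ## §4 The move lemma: changing the lift of the scheme by a derivation -/

section Move

variable (J : Ideal A') (hJ : J * J = ⊥) {𝔫' : Ideal A'} (hJ𝔫 : J * 𝔫' = ⊥)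

include hJ𝔫 in
/-- **THE MOVE LEMMA.**  Let `G₁ σ = G₂ Y` with `G₁ ≡ 1 ⊗ g₁`, `G₂ ≡ 1 ⊗ g₂`, `Y ≡ 1 ⊗ g₃ (mod 𝔫')` (`Y = ρ(G₃)` the
transported third unit) and `g₁ c = g₂` in `B₀`.  Moving the transition by the infinitesimal automorphism `θ_D` of a
derivation `D ∈ Der_k(B₀, B₀ ⊗_k J)` — i.e. replacing `Y` by `θ_D(Y)` — replaces `σ` by `σ + ι(c • D g₃)`:
`G₁ (σ + ι(c • D g₃)) = G₂ θ_D(Y)`.  With the closed-fibre cocycle `g₂ g₃ = g₁` one has `c = g₃⁻¹` and the shift is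
`ι(g₃⁻¹ D g₃) = ⟨D, dlog g₃⟩` («the obstruction to lifting the invertible sheaf changes by the cup product of the
derivation cochain with `dlog` of its transition functions»). [cite: Sernesi2006, Thm. 3.3.11 and (3.38)]
[cite: Hartshorne2010, Remark 10.1.1, p. 80] [cite: Oort1971, §2.3] -/
theorem twistedDefect_move (D : Derivation k B₀ (B₀ ⊗[k] ↥(J.restrictScalars k)))
    {G₁ G₂ Y σ : A' ⊗[k] B₀} {g₁ g₂ g₃ c : B₀}
    (hG₁ : G₁ - (1 : A') ⊗ₜ g₁ ∈ 𝔫' • (⊤ : Submodule A' (A' ⊗[k] B₀)))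
    (hG₂ : G₂ - (1 : A') ⊗ₜ g₂ ∈ 𝔫' • (⊤ : Submodule A' (A' ⊗[k] B₀)))
    (hY : Y - (1 : A') ⊗ₜ g₃ ∈ 𝔫' • (⊤ : Submodule A' (A' ⊗[k] B₀)))
    (hσ : G₁ * σ = G₂ * Y) (hc : g₁ * c = g₂) :
    G₁ * (σ + idealTensorIncl J (c • D g₃)) = G₂ * infinitesimalAut J hJ D Y := by
  rw [infinitesimalAut_apply_of_sub_mem J hJ hJ𝔫 D hY, mul_add, mul_add, hσ,
    mul_idealTensorIncl_of_sub_mem J hJ𝔫 hG₁, mul_idealTensorIncl_of_sub_mem J hJ𝔫 hG₂, smul_smul, hc]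

include hJ𝔫 in
/-- **The move lemma against the closed-fibre cocycle**: with `g₂ g₃ = g₁` and `g₃ c = 1` the shift is `ι(c • D g₃)`,
`c = g₃⁻¹` — the `(j,l,m)`-component `⟨D_{jl}, dlog g_{lm}⟩` of the cup product. [cite: Sernesi2006, Thm. 3.3.11 and (3.38)]
[cite: Oort1971, §2.3] -/
theorem twistedDefect_move_of_cocycle (D : Derivation k B₀ (B₀ ⊗[k] ↥(J.restrictScalars k)))
    (ρ : A' ⊗[k] B₀ ≃ₐ[A'] A' ⊗[k] B₀) (hρ : ∀ y, ρ y - y ∈ 𝔫' • (⊤ : Submodule A' (A' ⊗[k] B₀)))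
    {G₁ G₂ G₃ σ : A' ⊗[k] B₀} {g₁ g₂ g₃ c : B₀}
    (hG₁ : G₁ - (1 : A') ⊗ₜ g₁ ∈ 𝔫' • (⊤ : Submodule A' (A' ⊗[k] B₀)))
    (hG₂ : G₂ - (1 : A') ⊗ₜ g₂ ∈ 𝔫' • (⊤ : Submodule A' (A' ⊗[k] B₀)))
    (hG₃ : G₃ - (1 : A') ⊗ₜ g₃ ∈ 𝔫' • (⊤ : Submodule A' (A' ⊗[k] B₀)))
    (hσ : G₁ * σ = G₂ * ρ G₃) (hg : g₂ * g₃ = g₁) (hc : g₃ * c = 1) :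
    G₁ * (σ + idealTensorIncl J (c • D g₃)) = G₂ * (infinitesimalAut J hJ D * ρ) G₃ := by
  rw [AlgEquiv.mul_apply]
  refine twistedDefect_move J hJ hJ𝔫 D hG₁ hG₂ (apply_sub_tmul_mem ρ hρ hG₃) hσ ?_
  rw [← hg, mul_assoc, hc, mul_one]

/-- **The moved transitions still induce the identity modulo `𝔫'`** (`J ≤ 𝔫'`).
[cite: Hartshorne2010, Thm. 10.2 (proof), p. 81] -/
theorem sub_mem_smul_top_infinitesimalAut_mul (hJle : J ≤ 𝔫') (D : Derivation k B₀ (B₀ ⊗[k] ↥(J.restrictScalars k)))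
    (ρ : A' ⊗[k] B₀ ≃ₐ[A'] A' ⊗[k] B₀) (hρ : ∀ y, ρ y - y ∈ 𝔫' • (⊤ : Submodule A' (A' ⊗[k] B₀)))
    (y : A' ⊗[k] B₀) : (infinitesimalAut J hJ D * ρ) y - y ∈ 𝔫' • (⊤ : Submodule A' (A' ⊗[k] B₀)) := by
  rw [AlgEquiv.mul_apply]
  have h : infinitesimalAut J hJ D (ρ y) - y = (infinitesimalAut J hJ D (ρ y) - ρ y) + (ρ y - y) := by abel
  rw [h]
  exact Submodule.add_mem _ (smul_top_mono hJle (infinitesimalAut_apply_sub_mem J hJ D (ρ y))) (hρ y)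

include hJ𝔫 in
/-- **The moved transitions are again COCYCLE-EXACT when the derivations form a cocycle**: if `ρ₂₃ ρ₁₂ = ρ₁₃`
(composition of automorphisms), `ρ₂₃ ≡ 1 (mod 𝔫')` and `D₁₂ + D₂₃ = D₁₃`, then
`(θ_{D₂₃} ρ₂₃)(θ_{D₁₂} ρ₁₂) = θ_{D₁₃} ρ₁₃` — by centrality `θ_D ρ = ρ θ_D` (★ `infinitesimalAut_mul_comm`) and
`θ_{D + D'} = θ_D θ_{D'}`. [cite: Hartshorne2010, Remark 10.1.1 and Thm. 10.2 (proof), p. 81] -/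
theorem infinitesimalAut_mul_cocycle {ρ₁₂ ρ₂₃ ρ₁₃ : A' ⊗[k] B₀ ≃ₐ[A'] A' ⊗[k] B₀}
    (hρ₂₃ : ∀ y, ρ₂₃ y - y ∈ 𝔫' • (⊤ : Submodule A' (A' ⊗[k] B₀))) (hcoc : ρ₂₃ * ρ₁₂ = ρ₁₃)
    {D₁₂ D₂₃ D₁₃ : Derivation k B₀ (B₀ ⊗[k] ↥(J.restrictScalars k))} (hD : D₁₂ + D₂₃ = D₁₃) :
    (infinitesimalAut J hJ D₂₃ * ρ₂₃) * (infinitesimalAut J hJ D₁₂ * ρ₁₂) = infinitesimalAut J hJ D₁₃ * ρ₁₃ := by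
  rw [mul_assoc, ← mul_assoc ρ₂₃, ← infinitesimalAut_mul_comm J hJ hJ𝔫 ρ₂₃ hρ₂₃ D₁₂, mul_assoc, hcoc, ← mul_assoc,
    ← infinitesimalAut_add, add_comm, hD]

end Move

end Literature.AlgebraicGeometry.Deformation.SmoothAffineDeformation
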